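import Summits.QuantumFields.YangMills.Theorems.BalabanUVNodesN05SubBP2DSlotExistsLawLanGammaPrime

/-!
# BalabanUVNodes ∕ N05 ([Balaban1985RegularSpaces] Lemma 1 p. 79 – Thm 8 p. 101): THE «P₂D» SLOT ROW WITH THE WITNESS GUARDED — `∃ lam c₁ ρ₀, 0 < c₁ ∧ 1 ≤ ρ₀ ∧
# B8LeafOfRecordSubBP₂D θ (lam.cutSubBP₅ c₁ ρ₀)` — the guarded editions of this seat's `exists_residB8_layer` (p611162) and of the N05 row supplier of record
# `exists_residB8_b8LeafOfRecordSubBP₂D_cutSubBP₅_of_lettersSrc_γ'` (p619291): the Proposition-6 pair `(ρ₀, c₁⋆)` is print's (`1 ≤ ρ₀`, `0 < c₁⋆` —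
# `B8Prop6PrintedZdCubPGamma.prop6Printed_zdCubP_γ_holds_record_dvd` delivers both; p611162 discarded them), so the slot's Proposition-6 conjunct is never the vacuous one

Track A of `YM-PLAN.md` (cell `pub-ymgap`, HUMAN RULING D-0062), node **N05**; seat `pub-ymgap-dag-n05-d` (g14), 2026-08-28; bears on K1⁹ `stmt-QuantumFields-27364`
(`--supports … --as helper`, count-neutral).

WHY (director-ym №217 (2)(i), cell bus 2026-08-28 12:50Z; ref-D VERDICT-415).  The N05 slot of record is consumed in ∃-currency, `Slot8 := fun θ₃ λ₈ => ∃ c₁ ρ₀,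
B8LeafOfRecordSubBP₂D θ₃ (λ₈.cutSubBP₅ c₁ ρ₀)`, with `c₁ : ℝ`, `ρ₀ : ℕ` UNGUARDED; the slot's Proposition-6 conjunct `B8.Prop6Printed d L B₁ c₁ cub` has the premise
`7·d·L²·sizeM c·α₀ ≤ c₁` — false for `c₁ < 0`, so at `c₁ := −1` that conjunct is VACUOUS, and an N05 discharge «is not bookable on an unguarded slot; a witness must carry
`0 < c₁ ∧ 1 ≤ ρ₀` or the row is guarded first».  This seat's ∃λ suppliers (p619291 and everything composed on it: the junction editions p627269 ∕ p628513, dag-n05-e's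
p629759 ∕ p632654, p633678, the record images) prove the UNGUARDED ∃ although their witness IS print's: `(ρ₀, B₁⋆, c₁⋆)` comes from
`prop6Printed_zdCubP_γ_holds_record_dvd θ hD hL5 (t := 1)`, which states `1 ≤ ρ₀ ∧ t ∣ ρ₀ ∧ 0 < B₁⋆ ∧ 0 < c₁⋆` — the layer lemma `exists_residB8_layer` (p611162)
pattern-matched those two facts away (`⟨ρ₀, B₁s, c₁s, -, -, hB₁s, -, hP6⟩`).  THIS FILE keeps them: the row is GUARDED FIRST, at its root.

WHAT IS PROVED (two theorems; the proofs are p611162's §Layer and p619291's VERBATIM with the two facts threaded; private arithmetic helpers copied from p611162;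
no estimate; no new definition):
* ★ `exists_residB8_layer_guarded` — p611162's `exists_residB8_layer` with `1 ≤ ρ₀ ∧ 0 < c₁s ∧` prepended to its conclusion.
* ★★★ **`exists_residB8_b8LeafOfRecordSubBP₂D_cutSubBP₅_of_lettersSrc_γ'_guarded`** — p619291's hypotheses VERBATIM ⊢ `∃ lam c₁ ρ₀, 0 < c₁ ∧ 1 ≤ ρ₀ ∧
  B8LeafOfRecordSubBP₂D θ (lam.cutSubBP₅ c₁ ρ₀)` (the guard in director-ym №217's order; hence `∃ λ₈, Slot8′ θ λ₈` for the guarded slot instance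
  `Slot8′ := fun θ₃ λ₈ => ∃ c₁ ρ₀, 0 < c₁ ∧ 1 ≤ ρ₀ ∧ …` of the K1 knit, by `⟨lam, c₁, ρ₀, hc₁, hρ₀, h⟩`).
The guarded junction editions (`…_junctionH ∕ _withQQP ∕ _P6 ∕ _P6I ∕ _zdFrame ∕ _zdFrameI`) and record images follow in the companion `…OfThm33JunctionHGuarded`.
HONEST FRAMING: bookkeeping (two facts re-threaded); 0 estimates; the five [4]-type families (`SLet ∕ SLetUB ∕ SB9P ∕ SH59src ∕ SB9srcHP`) are HYPOTHESES exactly as in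
p619291 (N06 content, `m ≥ 1` OPEN); Proposition 7 in the repaired currency (WATCH-P7-CURRENCY-RECORD); the unguarded p619291 stays (true, weaker); count-neutral;
**N05 NOT discharged**; K1⁹ NOT claimed; Bałaban AS PRINTED; one finite 𝕋⁴ programme at fixed ε; nothing continuum ∕ ℝ⁴ ∕ OS ∕ mass-gap ∕ Clay.  No `sorry`, no new
definition.  Unit `pub-ymgap-dag-n05-d` (g14).
[cite: Balaban1985RegularSpaces, Lemma 1 p.79, Thm 2 p.83, Prop. 3 p.87, Thm 4 p.88, Prop. 5 p.94, Prop. 6 (1.134)–(1.138) p.99, Prop. 7 p.100, Thm 8 (1.146) p.101, (1.3)–(1.5) p.77; Balaban1985BackgroundPropagators, Thm 3.1 p.397, Thm 3.3 p.399, (3.40) p.397]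
-/

noncomputable section

namespace Summit.QuantumFields.YangMills.BalabanUVNodes.N05SubBP2DSlotExistsGuarded

open Literature.MathematicalPhysics.QuantumFieldTheory.Balaban1983to89
open Literature.MathematicalPhysics.QuantumFieldTheory.Balaban1983to89.Node00
open Literature.MathematicalPhysics.QuantumFieldTheory.Balaban1983to89.B8IdxB8LawsB (IdxB8LawsB IdxB8SubB)
open Literature.MathematicalPhysics.QuantumFieldTheory.Balaban1983to89.B8LeafModelZd (ZdIdx)
open Literature.MathematicalPhysics.QuantumFieldTheory.Balaban1983to89.B8LeafModelZd3 (SockB9P3)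
open Literature.MathematicalPhysics.QuantumFieldTheory.Balaban1983to89.B9SupplySockB9P3ZdGammaUnivDelta2 (SockB9P3H2)
open Literature.MathematicalPhysics.QuantumFieldTheory.Balaban1983to89.B8LeafModelZd3P (zdGF3P zdGF3HP)
open Literature.MathematicalPhysics.QuantumFieldTheory.Balaban1983to89.B8LeafModelZd3P2 (zdGF3P₂ zdGF3HP₂)
open Literature.MathematicalPhysics.QuantumFieldTheory.Balaban1983to89.B8TowerBondsPrinted (towerBondsP)
open Literature.MathematicalPhysics.QuantumFieldTheory.Balaban1983to89.B8SockLettersRD (SockLettersRD)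
open Literature.MathematicalPhysics.QuantumFieldTheory.Balaban1983to89.B8Lemma1NonAbelian (mulCfg blockPairNA)
open Literature.MathematicalPhysics.QuantumFieldTheory.Balaban1983to89.B8LanF146 (LanF146)
open Literature.MathematicalPhysics.QuantumFieldTheory.Balaban1983to89.B8Eq138LandauZd (covLap QT InR138 IsLandau146W)
open Literature.MathematicalPhysics.QuantumFieldTheory.Balaban1983to89.B8Prop5LandauDataZd (ZdLanIdx zdLan)
open Summit.QuantumFields.YangMills.BalabanUVNodes.N05SubBP2DSlotGammaPrime (b8LeafOfRecordSubBP₂D_cutSubBP_zdLan_printCube_of_knit_lettersSrc_γ')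
open MatrixLog B7Prop1Explicit B7Prop2Explicit B7Prop1Local B7Eq92Concrete
open B8Ineq130 (tlo thi)
open B8Ineq132 (InAk covDerivFwd)
open B7Eq78Linearization (zdBlocking QprimeIter)
open B8Eq119TwistedAxial (bgT Restr129 InAx)
open B8Eq140Level (SideTouches)
open B8Eq1117Concrete (XSpace)
open B8Prop5ContractionKLevel (Bd2)
open B8LambdaSpaceKLevel (wt)
open B8Eq184Proof (gaugeExp cfgExp)
open B8Eq146AExpansion (iEta plaqCovDeriv)
open B8Eq143PlaqExpansion (pdiv)
open B7Prop4GeneralLevels (linCovIter)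
open B8Eq155JBound (Jcur wsup)
open B8ScaledSupNorm (bondNorm msup Bdd)
open B9Eq340HolderZd (hquot AdmPair)

-- `Site` alone could resolve to the torus sites of `Setup.lean`; re-export the `ℤ^d` sites of `B7Prop1Explicit`.
export B7Prop1Explicit (Site)

open Literature.MathematicalPhysics.QuantumFieldTheory.Balaban1983to89.B8Prop6PrintedZdCubPGamma (prop6Printed_zdCubP_γ_holds_record_dvd)
open B8ScaledSupNorm (msup_le bdd_of_forall)
open Literature.MathematicalPhysics.QuantumFieldTheory.Balaban1983to89.B8LanF146 (lanF146_zero_iff)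
open Literature.MathematicalPhysics.QuantumFieldTheory.Balaban1983to89.B8Eq138LandauZd (inR138_zero)
open Literature.MathematicalPhysics.QuantumFieldTheory.Balaban1983to89.B8LeafKnitRSC (B8LeafRSC)
open Literature.MathematicalPhysics.QuantumFieldTheory.Balaban1983to89.B8Prop7TowerAxialRecord (toAxialTowerResid)

/-! ### Arithmetic of the chosen constants (plain real numbers; kept out of the socket-laden main context) -/

/-- `1 ≤ 5dL` and `0 < 5dL` for `d ≥ 2`, `L ≥ 5`. [cite: Balaban1985RegularSpaces, Prop. 3 p.87 (the constant `5dL`, bookkeeping)] -/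
private theorem fiveDL_bounds {D L : ℝ} (hD : 2 ≤ D) (hL : 5 ≤ L) : 1 ≤ 5 * D * L ∧ 0 < 5 * D * L := by
  constructor <;> nlinarith

/-- `2 ≤ M·B₀` with `M > 0` forces `B₀ > 0`. [cite: Balaban1985BackgroundPropagators, (3.40) p.397 (the constant `B₀`, bookkeeping)] -/
private theorem pos_of_two_le_mul {M B₀ : ℝ} (hM : 0 < M) (h : 2 ≤ M * B₀) : 0 < B₀ := by
  by_contra h'
  have : M * B₀ ≤ 0 := mul_nonpos_of_nonneg_of_nonpos hM.le (not_lt.1 h')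
  linarith

/-- THE CHOICE OF THEOREM 8's AUXILIARY CONSTANT `B₈ := B₀ + γ₈ + B₁⋆ + 2(γ′+γ″)B₀∕M` (`M = 5dL ≥ 1`, `E = 1 + 11d² ≥ 1`): it dominates `B₀`, `γ₈`, leaves room
for the slacks `γ′`, `γ″`, and `B₁⋆ ≤ M·B₈·E`. [cite: Balaban1985RegularSpaces, Thm 8 (1.146) p.101, Prop. 3 p.87 (shape of the constants, bookkeeping)] -/
private theorem exists_B₈ {M E B₀ γ₈ B₁s γ' γ'' : ℝ} (hM : 1 ≤ M) (hE : 1 ≤ E) (hB₀ : 0 < B₀) (hγ₈ : 1 ≤ γ₈) (hγ' : 0 ≤ γ') (hγ'' : 0 ≤ γ'')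
    (hB₁s : 0 < B₁s) :
    ∃ B₈ : ℝ, 0 ≤ B₈ ∧ B₀ ≤ B₈ ∧ γ₈ ≤ B₈ ∧ M * B₀ + 2 * (γ' * B₀) ≤ M * B₈ ∧ M * B₀ + 2 * (γ'' * B₀) ≤ M * B₈ ∧ B₁s ≤ M * B₈ * E := by
  have hM0 : 0 < M := lt_of_lt_of_le one_pos hM
  have h1 : 0 ≤ γ' * B₀ := mul_nonneg hγ' hB₀.le
  have h2 : 0 ≤ γ'' * B₀ := mul_nonneg hγ'' hB₀.le
  have h3 : 0 ≤ 2 * ((γ' + γ'') * B₀) / M := by positivity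
  have h4 : M * (B₀ + γ₈ + B₁s + 2 * ((γ' + γ'') * B₀) / M) = M * B₀ + M * γ₈ + M * B₁s + 2 * ((γ' + γ'') * B₀) := by
    field_simp
  have h5 : γ₈ ≤ M * γ₈ := by nlinarith
  have h6 : B₁s ≤ M * B₁s := by nlinarith
  refine ⟨B₀ + γ₈ + B₁s + 2 * ((γ' + γ'') * B₀) / M, by linarith, by linarith, by linarith, ?_, ?_, ?_⟩
  · rw [h4]; nlinarith
  · rw [h4]; nlinarith
  · have h7 : 0 ≤ M * (B₀ + γ₈ + B₁s + 2 * ((γ' + γ'') * B₀) / M) := by rw [h4]; nlinarith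
    have h8 : M * (B₀ + γ₈ + B₁s + 2 * ((γ' + γ'') * B₀) / M) ≤ M * (B₀ + γ₈ + B₁s + 2 * ((γ' + γ'') * B₀) / M) * E :=
      le_mul_of_one_le_right h7 hE
    rw [h4] at h8 ⊢
    nlinarith

/-- THE CHOICE OF THEOREM 8's AUXILIARY HÖLDER CONSTANT `B₈(β₀) := B₀(β₀) + (2B₀(β₀)γ″B₀ + γβ)∕M`. [cite: Balaban1985RegularSpaces, Thm 8 (1.146) p.101 (bookkeeping)] -/
private theorem exists_B₈β {M B₀β γ'' B₀ γβ : ℝ} (hM : 0 < M) : ∃ B₈β : ℝ, M * B₀β + 2 * B₀β * (γ'' * B₀) + γβ ≤ M * B₈β :=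
  ⟨B₀β + (2 * B₀β * (γ'' * B₀) + γβ) / M, le_of_eq (by rw [mul_add, mul_div_cancel₀ _ hM.ne', add_assoc])⟩

/-- THE CHOICE OF PROPOSITION 5's `B₀′ := 2K + 1` (`K = 3(2dL²)·BG·BR ≥ 0`): both free-constant guards hold once `γ₈ ≤ B₈`.
[cite: Balaban1985RegularSpaces, Prop. 5 (1.101)–(1.105) p.94 (the constant `B₀′`, bookkeeping)] -/
private theorem free_guards {K γ₈ B₈ : ℝ} (hK : 0 ≤ K) (h : γ₈ ≤ B₈) (hB₈ : 0 ≤ B₈) :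
    K ≤ (2 * K + 1) / 2 ∧ K * (B₈ + γ₈) ≤ (2 * K + 1) * B₈ := by
  refine ⟨by linarith, ?_⟩
  have h1 : K * γ₈ ≤ K * B₈ := mul_le_mul_of_nonneg_left h hK
  nlinarith

/-- Theorem 8's gauge-field radius `2L·(M B₈) + 64B₀′·(M B₈)` is non-negative. [cite: Balaban1985RegularSpaces, Thm 8 (1.146) p.101 (bookkeeping)] -/
private theorem radius_nonneg {L M B₈ B₀' : ℝ} (hL : 0 ≤ L) (hM : 0 ≤ M) (hB₈ : 0 ≤ B₈) (hB₀' : 0 ≤ B₀') :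
    0 ≤ 2 * (L * (M * B₈)) + 8 * (8 * B₀' * (M * B₈)) := by positivity

section Layer

/-- ★ **THE CHOSEN RESIDUAL LAYER, EXPOSED — GUARDED EDITION** (`1 ≤ ρ₀ ∧ 0 < c₁⋆` KEPT from `prop6Printed_zdCubP_γ_holds_record_dvd`, which the unguarded `exists_residB8_layer` (p611162) dropped) — (the arithmetic of `exists_residB8_b8LeafOfRecordSubBP₂C_of_lettersSrc_γ'` packaged for the knits that name
Proposition 5's family themselves, e.g. `BalabanUVNodesN05SubBP2CSlotExistsLawLanGammaPrime`): for `2 ≤ θ.D`, `5 ≤ θ.L`, [4]'s `B₀` with `2 ≤ 5dLB₀`, `BG, BR ≥ 0`, the Hölder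
data and Theorem 8's socket-side constants `γ₈ ≥ 1`, `γ′, γ″ ≥ 0`, `γβ`, THERE ARE Proposition 6's `(ρ₀, B₁⋆, c₁⋆)` (p596570, monotone clause), Theorem 8's auxiliary
`B₈ ≥ max(B₀, 0)`, `B₈(β₀)` and a residual layer `lam` reading `B₀, B₀(β₀), β, len` with `C₂ = 2²¹(d+1)²L²`, `B₁′ = 5dLB₈`, `B₁ = 5dLB₈(1+11d²) ≥ B₁⋆`,
`B₂ = 5dLB₈(β₀)(1+11d²)`, the three slack guards, both free-constant guards at `lam.inp.B₀′`, and Theorem 8's gauge-field radius `2L·5dLB₈ + 64B₀′·5dLB₈ ≥ 0` — every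
constant hypothesis of p606531's ★★★ except the sockets.  Bookkeeping only. [cite: Balaban1985RegularSpaces, Prop. 3 p.87, Prop. 5 p.94, Prop. 6 p.99, Thm 8 (1.146) p.101 (shape of the constants)] -/
theorem exists_residB8_layer_guarded (θ : Stage3Params) (hD : 2 ≤ θ.D) (hL5 : 5 ≤ θ.L) {B₀ B₀β β : ℝ} {len : Site θ.D → ℝ} {BG BR : ℝ} (hBG : 0 ≤ BG) (hBR : 0 ≤ BR)
    {γ₈ γ' γ'' : ℝ} (γβ : ℝ) (hγ₈ : 1 ≤ γ₈) (hγ' : 0 ≤ γ') (hγ'' : 0 ≤ γ'') (hB : 2 ≤ 5 * (θ.D : ℝ) * θ.L * B₀) :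
    ∃ (ρ₀ : ℕ) (B₁s c₁s B₈ B₈β : ℝ) (lam : ResidB8 θ), 1 ≤ ρ₀ ∧ 0 < c₁s ∧
      (∀ {ι : Type} (f : ι → ZdIdx θ.D θ.L) (B₁'' c₁'' : ℝ), B₁s ≤ B₁'' → c₁'' ≤ c₁s →
          B8.Prop6Printed θ.D (θ.L : ℝ) B₁'' c₁'' (fun j => zdCubP θ.𝔸 θ.L ρ₀ (f j))) ∧
      lam.inp.B₀ = B₀ ∧ lam.B₀β = B₀β ∧ lam.β = β ∧ lam.len = len ∧ lam.C₂ = 2097152 * ((θ.D : ℝ) + 1) ^ 2 * (θ.L : ℝ) ^ 2 ∧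
      lam.B₁' = 5 * (θ.D : ℝ) * θ.L * B₈ ∧ lam.B₁ = 5 * (θ.D : ℝ) * θ.L * B₈ * (1 + 11 * (θ.D : ℝ) ^ 2) ∧
      lam.B₂ = 5 * (θ.D : ℝ) * θ.L * B₈β * (1 + 11 * (θ.D : ℝ) ^ 2) ∧ B₁s ≤ lam.B₁ ∧ 0 ≤ B₈ ∧ B₀ ≤ B₈ ∧
      5 * (θ.D : ℝ) * θ.L * B₀ + 2 * (γ' * B₀) ≤ 5 * (θ.D : ℝ) * θ.L * B₈ ∧ 5 * (θ.D : ℝ) * θ.L * B₀ + 2 * (γ'' * B₀) ≤ 5 * (θ.D : ℝ) * θ.L * B₈ ∧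
      5 * (θ.D : ℝ) * θ.L * B₀β + 2 * B₀β * (γ'' * B₀) + γβ ≤ 5 * (θ.D : ℝ) * θ.L * B₈β ∧
      3 * (2 * (θ.D : ℝ) * (θ.L : ℝ) ^ 2) * BG * BR ≤ lam.inp.B₀' / 2 ∧ 3 * (2 * (θ.D : ℝ) * (θ.L : ℝ) ^ 2) * BG * BR * (B₈ + γ₈) ≤ lam.inp.B₀' * B₈ ∧
      0 ≤ 2 * (θ.L * (5 * (θ.D : ℝ) * θ.L * B₈)) + 8 * (8 * lam.inp.B₀' * (5 * (θ.D : ℝ) * θ.L * B₈)) := by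
  obtain ⟨ρ₀, B₁s, c₁s, hρ₀, -, hB₁s, hc₁s, hP6⟩ := prop6Printed_zdCubP_γ_holds_record_dvd θ hD hL5 (t := 1) le_rfl
  have hD' : (2 : ℝ) ≤ θ.D := by exact_mod_cast hD
  have hL' : (5 : ℝ) ≤ θ.L := by exact_mod_cast hL5
  obtain ⟨hDL1, hDL⟩ := fiveDL_bounds hD' hL'
  have hE : (1 : ℝ) ≤ 1 + 11 * (θ.D : ℝ) ^ 2 := le_add_of_nonneg_right (mul_nonneg (by norm_num) (sq_nonneg _))
  have hB₀ : 0 < B₀ := pos_of_two_le_mul hDL hB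
  have hK0 : 0 ≤ 3 * (2 * (θ.D : ℝ) * (θ.L : ℝ) ^ 2) * BG * BR :=
    mul_nonneg (mul_nonneg (mul_nonneg (by norm_num) (mul_nonneg (mul_nonneg (by norm_num) (le_trans (by norm_num) hD')) (sq_nonneg _))) hBG) hBR
  obtain ⟨B₈, hB₈0, hB₀8, hγ8le, hγB, hγB'', hB₁sE⟩ := exists_B₈ hDL1 hE hB₀ hγ₈ hγ' hγ'' hB₁s
  obtain ⟨B₈β, hB8β⟩ := exists_B₈β (B₀β := B₀β) (γ'' := γ'') (B₀ := B₀) (γβ := γβ) hDL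
  obtain ⟨hf2, hfS⟩ := free_guards hK0 hγ8le hB₈0
  have hB₀' : 0 < 2 * (3 * (2 * (θ.D : ℝ) * (θ.L : ℝ) ^ 2) * BG * BR) + 1 := add_pos_of_nonneg_of_pos (mul_nonneg zero_le_two hK0) one_pos
  exact ⟨ρ₀, B₁s, c₁s, B₈, B₈β,
    { β := β, len := len, I8c := PEmpty, lan := fun i => i.elim, I8d := PEmpty, cub := fun i => i.elim, toAxial := fun _ _ U => U,
      inp := ⟨B₀, 2 * (3 * (2 * (θ.D : ℝ) * (θ.L : ℝ) ^ 2) * BG * BR) + 1, hB₀, hB₀'⟩,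
      C₂ := 2097152 * ((θ.D : ℝ) + 1) ^ 2 * (θ.L : ℝ) ^ 2, B₁' := 5 * (θ.D : ℝ) * θ.L * B₈,
      B₁ := 5 * (θ.D : ℝ) * θ.L * B₈ * (1 + 11 * (θ.D : ℝ) ^ 2), B₂ := 5 * (θ.D : ℝ) * θ.L * B₈β * (1 + 11 * (θ.D : ℝ) ^ 2), c₁ := 0, B₀β := B₀β },
    hρ₀, hc₁s, hP6, rfl, rfl, rfl, rfl, rfl, rfl, rfl, rfl, hB₁sE, hB₈0, hB₀8, hγB, hγB'', hB8β, hf2, hfS,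
    radius_nonneg (le_trans (by norm_num) hL') hDL.le hB₈0 hB₀'.le⟩

end Layer

section SlotExistsLawLanGuarded

/-- ★★★ **GUARDED EDITION** (director-ym №217 (2)(i), ref-D VERDICT-415: the witness CARRIES `0 < c₁ ∧ 1 ≤ ρ₀`, so the Proposition-6 conjunct of the slot is NOT the vacuous `c₁ < 0` instance) of
★★★ **THE «P₂D» SLOT INHABITED AT dag-n05-w1's P₅-PINNED PRINT-CLASS CUT, FROM FIVE (1.5)-KEYED [4]-TYPE FAMILIES** — Proposition 5's family IS print's
p. 94 family BY NAME (`λ.cutSubBP₅ c₁ ρ₀`: index `IdxB8LanC θ` = ((1.3)–(1.5)-admissible `Ω₀ = ℤᵈ` law member, unitary background), members `zdLan θ.L λ.B₁ ∘ toZdLanIdx`),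
so there is NO ∃ over Proposition 5's carriers and no certificate is needed.  For `θ` with `2 ≤ θ.D`, `5 ≤ θ.L`: [Balaban1985BackgroundPropagators]'s primitive
constants (positivity guards, `2 ≤ 5dLB₀`), its letters `SLet ∕ SLetUB` and the b9 sockets `SB9P ∕ SH59src ∕ SB9srcHP` at the (1.3)–(1.5)-admissible law members ⊢
`∃ lam c₁ ρ₀, B8LeafOfRecordSubBP₂D θ (lam.cutSubBP₅ c₁ ρ₀)`.  Proof: `exists_residB8_layer` (p611162); ONE application of p618522's
`b8LeafOfRecordSubBP₂D_cutSubBP_zdLan_printCube_of_knit_lettersSrc_γ'` at `ι := IdxB8LanC.toZdLanIdx` with the pin's faces `IdxB8LanC.hΩ0L ∕ hΩL ∕ htowerL`,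
`SLetL := SLet` at the member's top truncation (its (1.5) hypothesis := `a.mem.2`), `SLetLU := SLetUB`; the pin's `Iff.rfl` face `b8LeafOfRecordSubBP₂D_cutSubBP₅_iff_cutSubBP`.
Sockets ∕ letters are HYPOTHESES (N06); N05 NOT discharged. [cite: Balaban1985RegularSpaces, Lemma 1 – Thm 8 pp.79–101, Prop. 5 (1.106)–(1.110) p.94, (1.3)–(1.5) p.77; Balaban1985BackgroundPropagators, Thm 3.1 p.397, Thm 3.3 p.398, (3.40) p.397] -/
theorem exists_residB8_b8LeafOfRecordSubBP₂D_cutSubBP₅_of_lettersSrc_γ'_guarded (θ : Stage3Params) (hD : 2 ≤ θ.D) (hL5 : 5 ≤ θ.L)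
    -- [Balaban1985BackgroundPropagators]'s PRIMITIVE constants read by the sockets: `B₀` (3.40), the Hölder pair `(β, B₀(β₀))` and length function, [4]'s letter bounds
    {B₀ B₀β β : ℝ} {len : Site θ.D → ℝ}
    {cB9 B₀'H B₂' BG BR cL : ℝ}
    (hcB9 : 0 < cB9) (hB₀'H : 0 < B₀'H) (hB₂' : 0 ≤ B₂') (hBG : 0 ≤ BG) (hBR : 0 ≤ BR) (hcL : 0 < cL)
    -- [4]'s letters AT THE `Ω₀ = ℤᵈ` LAW MEMBERS ONLY: existence side (laws on print's domains) and uniqueness side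
    (SLet : ∀ i : ZdIdx θ.D θ.L, i.Ω 0 = Set.univ → IdxB8LawsB θ.L i → B8ConstraintBonds.DomainSeq θ.L i.Ω → (∀ l, l < i.k → ∀ z ∈ i.Λs i.k l, ((θ.L : ℤ) ^ l) • z ∈ B8ConstraintBonds.Lam θ.L i.Ω l) → SockLettersRD (𝔸 := θ.𝔸) θ.L BG BR B₀'H B₂' cL i.η i.k i.Ω i.Λs)
    (SLetUB : ∀ i : ZdIdx θ.D θ.L, i.Ω 0 = Set.univ → IdxB8LawsB θ.L i → B8ConstraintBonds.DomainSeq θ.L i.Ω → (∀ l, l < i.k → ∀ z ∈ i.Λs i.k l, ((θ.L : ℤ) ^ l) • z ∈ B8ConstraintBonds.Lam θ.L i.Ω l) → ∀ α₀ : ℝ, 0 < α₀ → α₀ ≤ cL → ∀ U₀ : Site θ.D → Fin θ.D → θ.𝔸ˣ, (∀ x κ, U₀ x κ ∈ unitaryUnits θ.𝔸) →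
      InAk θ.L i.k i.η α₀ i.Ω U₀ →
      ∃ (g Δ : (Site θ.D → θ.𝔸) →ₗ[ℂ] (Site θ.D → θ.𝔸)) (q : (Site θ.D → θ.𝔸) →ₗ[ℂ] (ℕ → Site θ.D → θ.𝔸))
        (qs : (ℕ → Site θ.D → θ.𝔸) →ₗ[ℂ] (Site θ.D → θ.𝔸)) (Aw c : (ℕ → Site θ.D → θ.𝔸) →ₗ[ℂ] (ℕ → Site θ.D → θ.𝔸))
        (H' : XSpace θ.D i.k θ.𝔸 →ₗ[ℂ] (Site θ.D → θ.𝔸)),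
        (∀ x : Site θ.D → θ.𝔸, (∃ C : ℝ, ∀ y, ‖x y‖ ≤ C) → g (Δ x + qs (Aw (q x))) = x) ∧ (∀ φ, qs (c (q (g (g (qs φ))))) = qs φ) ∧
        (∀ (f : Site θ.D → θ.𝔸), ∀ x ∈ i.Ω 0, Δ f x = covLap i.η U₀ ((i.Ω 0).indicator f) x) ∧
        (∀ (μ : ℕ → Site θ.D → θ.𝔸), ∀ x ∈ i.Ω 0, qs μ x = QT θ.L i.k (i.Λs i.k) U₀ μ x) ∧
        (∀ (f : Site θ.D → θ.𝔸) (n : ℕ), n ≤ i.k → ∀ y ∈ i.Λs i.k n, q f n y = QprimeIter (zdBlocking θ.D θ.L) (bgT θ.L U₀) n f y) ∧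
        (∀ (f : Site θ.D → θ.𝔸) (n : ℕ) (y : Site θ.D), ¬ (n ≤ i.k ∧ y ∈ i.Λs i.k n) → q f n y = 0) ∧
        (∀ (X : XSpace θ.D i.k θ.𝔸) (x : Site θ.D), ‖H' X x‖ ≤ B₀'H * ‖X‖) ∧
        (∀ n, n ≤ i.k → ∀ (X : XSpace θ.D i.k θ.𝔸), ∀ p ∈ {b : Site θ.D × Fin θ.D | SideTouches (i.Ω n) b.1 b.2},
          wt θ.L i.η n * ‖covDerivFwd i.η U₀ p.2 (H' X) p.1‖ ≤ B₀'H * ‖X‖) ∧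
        (∀ X : XSpace θ.D i.k θ.𝔸, Bd2 θ.L i.η i.k i.Ω (covLap i.η U₀ (H' X)) (B₂' * ‖X‖)) ∧
        (∀ (Y : XSpace θ.D i.k θ.𝔸) (n : ℕ) (hn : n ≤ i.k) (y : Site θ.D), y ∈ i.Λs i.k n →
          QprimeIter (zdBlocking θ.D θ.L) (bgT θ.L U₀) n (H' Y) y = Y (⟨n, Nat.lt_succ_of_le hn⟩, y)) ∧
        (∀ (f : Site θ.D → θ.𝔸) (r : ℝ), 0 ≤ r → Bd2 θ.L i.η i.k i.Ω f r →
          (∀ x, ‖g f x‖ ≤ BG * r) ∧ ∀ n, n ≤ i.k → ∀ p ∈ {b : Site θ.D × Fin θ.D | SideTouches (i.Ω n) b.1 b.2},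
            wt θ.L i.η n * ‖covDerivFwd i.η U₀ p.2 (g f) p.1‖ ≤ BG * r) ∧
        (∀ (f : Site θ.D → θ.𝔸) (r : ℝ), 0 ≤ r → Bd2 θ.L i.η i.k i.Ω f r → Bd2 θ.L i.η i.k i.Ω (f - g (qs (c (q (g f))))) (BR * r)))
    -- the SOURCELESS b9 socket of Proposition 3's frame over PRINT's class, at the law members only ([4] Thm 3.3; threshold `cB9`) — for Prop. 3 AS PRINTED
    (SB9P : ∀ i : ZdIdx θ.D θ.L, i.Ω 0 = Set.univ → IdxB8LawsB θ.L i → B8ConstraintBonds.DomainSeq θ.L i.Ω → (∀ l, l < i.k → ∀ z ∈ i.Λs i.k l, ((θ.L : ℤ) ^ l) • z ∈ B8ConstraintBonds.Lam θ.L i.Ω l) →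
      SockB9P3H2 (𝔸 := θ.𝔸) θ.L B₀ B₀β cB9 β len i.η i.k i.Ω i.Λs (fun m j => towerBondsP θ.L i.Ω (i.Λs m) j))
    -- THEOREM 8's SOCKET-SIDE constants (source threshold `cP3`, source size factor `γ₈`, remainder slacks `γ′ γ″ γβ`) and the guard `2 ≤ 5dLB₀` on [4]'s `B₀` —
    -- NO layer equation, NO auxiliary `B₈ ∕ B₈β`, NO free-constant guard: those are CHOSEN ∕ DERIVED in the proof
    {cP3 γ₈ γ' γ'' γβ : ℝ} (hcP3 : 0 < cP3) (hγ₈ : 1 ≤ γ₈) (hγ' : 0 ≤ γ') (hγ'' : 0 ≤ γ'')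
    (hB : 2 ≤ 5 * (θ.D : ℝ) * θ.L * B₀) (hB₀β : 0 < B₀β)
    -- [Balaban1985BackgroundPropagators] Thm 3.3 WITH SOURCE in Theorem 4's frame at (1.146), γ′ letter, at the law members ONLY, asked RADIUS-UNIFORMLY: for every
    -- gauge-field radius scale `r ≥ 0` SOME threshold `c59 > 0` (print needs the one radius `r = O(B₁)`; [4] Thm 3.3 gives every `r` by shrinking its threshold) — HYPOTHESIS
    (SH59src : ∀ r : ℝ, 0 ≤ r → ∃ c59 : ℝ, 0 < c59 ∧ ∀ i : ZdIdx θ.D θ.L, i.Ω 0 = Set.univ → IdxB8LawsB θ.L i → B8ConstraintBonds.DomainSeq θ.L i.Ω → (∀ l, l < i.k → ∀ z ∈ i.Λs i.k l, ((θ.L : ℤ) ^ l) • z ∈ B8ConstraintBonds.Lam θ.L i.Ω l) → ∀ α₀ α₁ : ℝ, 0 < α₀ → 0 < α₁ → α₀ + α₁ ≤ c59 →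
      ∀ U₀ U' : Site θ.D → Fin θ.D → θ.𝔸ˣ, (∀ x κ, U₀ x κ ∈ unitaryUnits θ.𝔸) → (∀ x κ, U' x κ ∈ unitaryUnits θ.𝔸) →
      ∀ φ : Site θ.D → θ.𝔸, ((InR138 θ.L i.k i.η (i.Ω 0) (i.Λs i.k) U₀ φ ∧ (∀ x, IsSelfAdjoint (φ x)) ∧ (∀ x, x ∉ i.Ω 0 → φ x = 0) ∧
          Bdd θ.L i.k i.η (-(2 : ℝ)) (fun j (x : Site θ.D) => x ∈ i.Ω j) φ) ∧
        msup θ.L i.k i.η (-(2 : ℝ)) (fun j (x : Site θ.D) => x ∈ i.Ω j) φ < γ₈ * (α₀ + α₁)) →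
      InAk θ.L i.k i.η α₀ i.Ω U₀ → InAk θ.L i.k i.η α₀ i.Ω (mulCfg U' U₀) → (∀ m, m ≤ i.k → InAx θ.L m (i.Λs m) U₀ (mulCfg U' U₀)) →
      (∀ j, j ≤ i.k → ∀ (z : Site θ.D) (μ : Fin θ.D),
        ((∀ x, InBox (tlo θ.L z j) (thi θ.L z j) x → x ∈ i.Ω j) ∨ (∀ x, InBox (tlo θ.L (z + e μ) j) (thi θ.L (z + e μ) j) x → x ∈ i.Ω j)) →
        ‖(avgIter θ.L (mulCfg U' U₀) j z μ : θ.𝔸) - (avgIter θ.L U₀ j z μ : θ.𝔸)‖ ≤ α₁) →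
      (∀ b ∈ {b : Site θ.D × Fin θ.D | SideTouches (i.Ω 0) b.1 b.2}, ‖((U' b.1 b.2 : θ.𝔸ˣ) : θ.𝔸) - 1‖ ≤ α₁) →
      (∀ m, 1 ≤ m → m ≤ i.k → ∀ (u : Site θ.D → θ.𝔸ˣ) (W : Site θ.D → Fin θ.D → θ.𝔸ˣ) (A' : Site θ.D → Fin θ.D → θ.𝔸),
        (∀ x, u x ∈ unitaryUnits θ.𝔸) → mgauge U₀ u W = U' → Restr129 θ.L m (i.Λs m) U₀ u → LanF146 θ.L i.k i.η (i.Ω 0) i.Λs U₀ φ m W →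
        (∀ y τ, IsSelfAdjoint (A' y τ)) →
        (∀ j, j ≤ m → ∀ y τ, SideTouches (i.Ω j) y τ →
        W y τ = cfgExp i.η A' y τ ∧ ‖A' y τ‖ ≤ r * (α₀ + α₁) * ((θ.L : ℝ) ^ j * i.η)⁻¹) →
        (∀ y τ, (∀ j, j ≤ m → ¬ SideTouches (i.Ω j) y τ) → A' y τ = 0) →
        msup θ.L m i.η (-(1 : ℝ)) (fun j (b : Site θ.D × Fin θ.D) => SideTouches (i.Ω j) b.1 b.2) (fun b => A' b.1 b.2)
        ≤ B₀ * (bondNorm θ.L m i.η (-(3 : ℝ)) i.Ω (fun x μ => Jcur i.η U₀ A' μ x)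
        + wsup 1 (fun p : {p : ℕ × (Site θ.D × Fin θ.D) // p.1 ≤ m ∧ p.2 ∈ towerBondsP θ.L i.Ω (i.Λs m) p.1} =>
        linCovIter θ.L U₀ (iEta i.η A') p.1.1 p.1.2.1 p.1.2.2)) + γ' * B₀ * (α₀ + α₁) ∧
        msup θ.L m i.η (-(2 : ℝ)) (fun j (t : Fin θ.D × Fin θ.D × Site θ.D) => SideTouches (i.Ω j) t.2.2 t.2.1)
        (fun t => covDerivFwd i.η U₀ t.1 (fun z => A' z t.2.1) t.2.2)
        ≤ B₀ * (bondNorm θ.L m i.η (-(3 : ℝ)) i.Ω (fun x μ => Jcur i.η U₀ A' μ x)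
        + wsup 1 (fun p : {p : ℕ × (Site θ.D × Fin θ.D) // p.1 ≤ m ∧ p.2 ∈ towerBondsP θ.L i.Ω (i.Λs m) p.1} =>
        linCovIter θ.L U₀ (iEta i.η A') p.1.1 p.1.2.1 p.1.2.2)) + γ' * B₀ * (α₀ + α₁)))
    -- THE SOURCED b9 SOCKET OF PROPOSITION 3's FRAME at the `Ω₀ = ℤᵈ` law members, threshold `cP3`, `|B₁|` over print's class at the top truncation — HYPOTHESIS
    -- ([Balaban1985BackgroundPropagators] Thm 3.3 with source; = `B8Prop3SrcZd3HPGamma`'s input letter for letter)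
    (SB9srcHP : ∀ i : ZdIdx θ.D θ.L, i.Ω 0 = Set.univ → IdxB8LawsB θ.L i → B8ConstraintBonds.DomainSeq θ.L i.Ω → (∀ l, l < i.k → ∀ z ∈ i.Λs i.k l, ((θ.L : ℤ) ^ l) • z ∈ B8ConstraintBonds.Lam θ.L i.Ω l) → ∀ α₀ α₁ α₂ : ℝ, 0 < α₀ → α₀ ≤ cP3 → 0 < α₁ → 0 < α₂ → α₂ ≤ cP3 →
      ∀ (U₀ W : Site θ.D → Fin θ.D → θ.𝔸ˣ), (∀ x κ, U₀ x κ ∈ unitaryUnits θ.𝔸) → (∀ x κ, W x κ ∈ unitaryUnits θ.𝔸) →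
      ∀ f : Site θ.D → θ.𝔸, InR138 θ.L i.k i.η (i.Ω 0) (i.Λs i.k) U₀ f →
      (∀ x, IsSelfAdjoint (f x)) → (∀ x, x ∉ i.Ω 0 → f x = 0) →
      Bdd θ.L i.k i.η (-(2 : ℝ)) (fun j (x : Site θ.D) => x ∈ i.Ω j) f →
      msup θ.L i.k i.η (-(2 : ℝ)) (fun j (x : Site θ.D) => x ∈ i.Ω j) f < γ₈ * (α₀ + α₁) →
      msup θ.L i.k i.η (-(3 : ℝ)) (fun j (p : Fin θ.D × Site θ.D) => p.2 ∈ i.Ω j) (fun p => covDerivFwd i.η U₀ p.1 f p.2) < γ₈ * (α₀ + α₁) →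
      InAk θ.L i.k i.η α₀ i.Ω U₀ → InAk θ.L i.k i.η α₀ i.Ω (mulCfg W U₀) → IsLandau146W θ.L i.k i.η (i.Ω 0) (i.Λs i.k) U₀ f W →
      ∀ A' : Site θ.D → Fin θ.D → θ.𝔸, (∀ y τ, IsSelfAdjoint (A' y τ)) →
      (∀ j, j ≤ i.k → ∀ (y : Site θ.D) (τ : Fin θ.D), SideTouches (i.Ω j) y τ →
        W y τ = cfgExp i.η A' y τ ∧ ‖A' y τ‖ ≤ α₂ * ((θ.L : ℝ) ^ j * i.η)⁻¹) →
      (∀ (y : Site θ.D) (τ : Fin θ.D), (∀ j, j ≤ i.k → ¬ SideTouches (i.Ω j) y τ) → A' y τ = 0) →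
      msup θ.L i.k i.η (-(1 : ℝ)) (fun j (b : Site θ.D × Fin θ.D) => SideTouches (i.Ω j) b.1 b.2) (fun b => A' b.1 b.2)
          ≤ B₀ * (bondNorm θ.L i.k i.η (-(3 : ℝ)) i.Ω (fun x μ => Jcur i.η U₀ A' μ x)
            + wsup 1 (fun p : {p : ℕ × (Site θ.D × Fin θ.D) // p.1 ≤ i.k ∧ p.2 ∈ towerBondsP θ.L i.Ω (i.Λs i.k) p.1} =>
                linCovIter θ.L U₀ (iEta i.η A') p.1.1 p.1.2.1 p.1.2.2)) + γ'' * B₀ * (α₀ + α₁) ∧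
        msup θ.L i.k i.η (-(2 : ℝ)) (fun j (t : Fin θ.D × Fin θ.D × Site θ.D) => SideTouches (i.Ω j) t.2.2 t.2.1)
            (fun t => covDerivFwd i.η U₀ t.1 (fun z => A' z t.2.1) t.2.2)
          ≤ B₀ * (bondNorm θ.L i.k i.η (-(3 : ℝ)) i.Ω (fun x μ => Jcur i.η U₀ A' μ x)
            + wsup 1 (fun p : {p : ℕ × (Site θ.D × Fin θ.D) // p.1 ≤ i.k ∧ p.2 ∈ towerBondsP θ.L i.Ω (i.Λs i.k) p.1} =>
                linCovIter θ.L U₀ (iEta i.η A') p.1.1 p.1.2.1 p.1.2.2)) + γ'' * B₀ * (α₀ + α₁) ∧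
        bondNorm θ.L i.k i.η (-(3 : ℝ)) i.Ω (fun x μ => pdiv i.η U₀ (plaqCovDeriv i.η U₀ A') μ x)
          ≤ B₀ * (bondNorm θ.L i.k i.η (-(3 : ℝ)) i.Ω (fun x μ => Jcur i.η U₀ A' μ x)
            + wsup 1 (fun p : {p : ℕ × (Site θ.D × Fin θ.D) // p.1 ≤ i.k ∧ p.2 ∈ towerBondsP θ.L i.Ω (i.Λs i.k) p.1} =>
                linCovIter θ.L U₀ (iEta i.η A') p.1.1 p.1.2.1 p.1.2.2)) + γ'' * B₀ * (α₀ + α₁) ∧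
        bondNorm θ.L i.k i.η (-(3 : ℝ)) i.Ω (fun x μ => covLap i.η U₀ (fun z => A' z μ) x)
          ≤ B₀ * (bondNorm θ.L i.k i.η (-(3 : ℝ)) i.Ω (fun x μ => Jcur i.η U₀ A' μ x)
            + wsup 1 (fun p : {p : ℕ × (Site θ.D × Fin θ.D) // p.1 ≤ i.k ∧ p.2 ∈ towerBondsP θ.L i.Ω (i.Λs i.k) p.1} =>
                linCovIter θ.L U₀ (iEta i.η A') p.1.1 p.1.2.1 p.1.2.2)) + γ'' * B₀ * (α₀ + α₁) ∧
        msup θ.L i.k i.η (-(2 + β)) (fun j (q : Fin θ.D × Fin θ.D × (Site θ.D × Site θ.D)) => q.2.2 ∈ AdmPair i.η len ∧ q.2.2.1 ∈ i.Ω j ∧ q.2.2.2 ∈ i.Ω j)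
            (fun q => hquot i.η β len U₀ (covDerivFwd i.η U₀ q.1 (fun z => A' z q.2.1)) q.2.2)
          ≤ B₀β * (bondNorm θ.L i.k i.η (-(3 : ℝ)) i.Ω (fun x μ => Jcur i.η U₀ A' μ x)
            + wsup 1 (fun p : {p : ℕ × (Site θ.D × Fin θ.D) // p.1 ≤ i.k ∧ p.2 ∈ towerBondsP θ.L i.Ω (i.Λs i.k) p.1} =>
                linCovIter θ.L U₀ (iEta i.η A') p.1.1 p.1.2.1 p.1.2.2)) + γβ * (α₀ + α₁)) :
    ∃ (lam : ResidB8 θ) (c₁ : ℝ) (ρ₀ : ℕ), 0 < c₁ ∧ 1 ≤ ρ₀ ∧ B8LeafOfRecordSubBP₂D θ (lam.cutSubBP₅ c₁ ρ₀) := by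
  -- the chosen constants and layer, GUARDED (`exists_residB8_layer_guarded` §1: `1 ≤ ρ₀`, `0 < c₁⋆` kept)
  obtain ⟨ρ₀, B₁s, c₁s, B₈, B₈β, lam, hρ₀, hc₁s, hP6, rfl, rfl, rfl, rfl, hC₂eq, hB₁', hB₁eq, hB₂eq, hB₁big, -, hB₀8, hγB, hγB'', hB8β, hfree2, hfreeS, hr0⟩ :=
    exists_residB8_layer_guarded θ hD hL5 (β := β) (len := len) (B₀β := B₀β) hBG hBR γβ hγ₈ hγ' hγ'' hB
  obtain ⟨c59, hc59, SH⟩ := SH59src _ hr0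
  -- PROPOSITION 5's family PINNED BY NAME: dag-n05-w1's `λ.cutSubBP₅ c₁⋆ ρ₀` = the print-class cut at `(IdxB8LanC θ, zdLan θ.L λ.B₁ ∘ toZdLanIdx)` (`rfl`); the
  -- `zdLan` laws are the pin's faces, the `zdLan` letters are [4]'s letters AT THE MEMBER (`SLet` at the top truncation, `SLetUB` verbatim)
  refine ⟨lam, c₁s, ρ₀, hc₁s, hρ₀, (b8LeafOfRecordSubBP₂D_cutSubBP₅_iff_cutSubBP lam c₁s ρ₀).2 ?_⟩
  refine b8LeafOfRecordSubBP₂D_cutSubBP_zdLan_printCube_of_knit_lettersSrc_γ' lam hD hC₂eq hcB9 hB₀'H hB₂' hBG hBR hcL SLet SLetUB SB9P hfree2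
      IdxB8LanC.toZdLanIdx IdxB8LanC.hΩ0L IdxB8LanC.hΩL IdxB8LanC.htowerL ?_ ?_ hP6 hB₁big hc59 hcP3 hγ₈ hγ' hγ'' hB hB₀β hB₀8 hγB hγB'' hB8β hB₁' hB₁eq hB₂eq
      hfreeS
      (fun i hΩ hl hd hlt α₀ α₁ hα₀ hα₁ hαc U₀ U' hU₀ hU' φ hφ hIn hIn' hAx h135 hbd m hm1 hmk u W A' hu hg hR hLan hsa hW hA0 =>
        SH i hΩ hl hd hlt α₀ α₁ hα₀ hα₁ hαc U₀ U' hU₀ hU' φ hφ hIn hIn' hAx h135 hbd m hm1 hmk u W A' hu hg hR hLan hsa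
          (fun j hj y τ hst => ⟨(hW j hj y τ hst).1, (hW j hj y τ hst).2.trans_eq (by ring)⟩) hA0)
      SB9srcHP
  · intro a α₀ hα₀ hαL hIn
    exact SLet a.mem.1.1.1.1 a.mem.1.1.1.2 a.mem.1.1.2 a.mem.1.2 a.mem.2 α₀ hα₀ hαL a.U₀ a.hU₀ hIn a.mem.1.1.1.1.k a.mem.1.1.1.1.hk le_rfl
  · intro a α₀ hα₀ hαL hIn
    exact SLetUB a.mem.1.1.1.1 a.mem.1.1.1.2 a.mem.1.1.2 a.mem.1.2 a.mem.2 α₀ hα₀ hαL a.U₀ a.hU₀ hIn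

end SlotExistsLawLanGuarded

end Summit.QuantumFields.YangMills.BalabanUVNodes.N05SubBP2DSlotExistsGuarded

end
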